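import Summits.CriticalPhenomena.PercolationContinuityZ3.Theorems.Transplant.FKDoubleFanOneSidedConeSShift
import HarnessLib

/-!
# Double fans `K₂ ∨ P_{m+1}`: the `a`-SIDED CONES ARE NOT `b`-STABLE — `HypBaS q`, `HypBa q` and `HypShiftS q C` are FALSE for every
# `0 < q < 1`

Helper file (`--supports stmt-CriticalPhenomena-4575`), FK sub-lane `prim-bschramm-fk-3` (gen 40); builds on p205010 (kernel theorem, internal
audit signed; external expert review pending).  No named facts, no sorries; standard axioms.  Memo `bschramm/prim-bschramm-fk-3/FAR-CROSS-XV.md`.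

NEGATIVE RESULT closing the one-sided-cone programme of gens 37–39 (`…OneSidedConeA`, `…OneSidedConeS`, `…ConeSCells`, `…ConeSShift`,
`…ConeSCross`, `…ConeSSigns`): their reductions are correct but their common hypothesis is false.

* **`pairH_imgA_sepBiv`** — an exact identity valid for all `q, F, w`:
  `⟪imgA q F w, γ_q⟫ = (1−q)²·N^{(ac)}(F)·[(2−q)(w₀² + w₀ w_ac + κ_ab(w)) + N^{(ab)}(w)]` for the explicit bivector
  **`sepBiv q`** `= e_uy + (1−q)·e_xv − e_yz`; equivalently the linear functional `(2−q)β_uy + β_xv + β_yz` of the hat–Plücker coordinates is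
  `≥ 0` on every `a`-image with `F, w ∈ Valid q` (hence on `InS × InS` and on `InKE × InKE`): **`sepBiv_osDualS`**, **`sepBiv_osDualA`**.
* **`pairH_witness`** — for the honest double-fan data `F₀ = E_{2/5} = rimStep q (2/5) fanInit = (3/5,0,2/5,0,0)` (one rim step),
  `w₀ = BC_{7/10} = (3/10,0,0,7/10,0)` (the prefix "one `b`-spoke"), `y = 7/10`:
  `⟪∧²BC_{7/10}(imgA q F₀ w₀), γ_q⟫ = (1−q)²·(−2322 + 1647q − 243q²)/125000 < 0` for `q < 1` (**`pairH_witness_neg`**).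
* Hence **`not_hypBaS`**: `¬ HypBaS q`, **`not_hypBa`**: `¬ HypBa q`, and **`not_hypShiftS`**: `¬ HypShiftS q C` (`C ≥ 0`), for all `0 < q < 1`:
  the image of the genuine word "input `BC_{7/10}`, pin `a c_j`, rim step `E_{2/5}`, `b`-spoke `BC_{7/10}`" lies OUTSIDE the closed cone generated
  by the `a`-fan images — the `b`-spoke after a rim step cannot be dominated by `a`-fans of modified inputs.  (Numerically the image IS in the
  two-sided cone generated by `a`- and `b`-fan images, memo §3: the dominance route `…OneSidedDominance` is not refuted by this functional, which is
  negative on some `b`-images.)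
[folklore]
-/

noncomputable section

namespace Summit.CriticalPhenomena.PercolationContinuityZ3.Theorems

namespace FK

namespace ThreeApex

/-! ### The separating functional -/

/-- The separating bivector `γ_q = e_uy + (1−q)e_xv − e_yz`: `⟪β, γ_q⟫ = (1−q)²((2−q)β_uy + β_xv + β_yz)`. [folklore] -/
def sepBiv (q : ℝ) : Biv := ⟨0, 1, 0, 0, 0, 0, 1 - q, -1, 0, 0⟩

/-- The pairing with `γ_q` is the hat–Plücker functional `(1−q)²((2−q)β_uy + β_xv + β_yz)`. [folklore] -/
theorem pairH_sepBiv (q : ℝ) (β : Biv) : pairH q β (sepBiv q) = (1 - q) ^ 2 * ((2 - q) * β.uy + β.xv + β.yz) := by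
  simp only [pairH, sepBiv]; ring

/-- **KEY IDENTITY.**  On `a`-images the functional factors through the master forms:
`⟪imgA q F w, γ_q⟫ = (1−q)²·N^{(ac)}(F)·[(2−q)(w₀² + w₀w_ac + κ_ab(w)) + N^{(ab)}(w)]`. [folklore] -/
theorem pairH_imgA_sepBiv (q : ℝ) (F w : V5) :
    pairH q (imgA q F w) (sepBiv q) =
      (1 - q) ^ 2 * (masterN q F * ((2 - q) * (w.z0 ^ 2 + w.z0 * w.zac + kap (swapBC w)) + masterN q (swapBC w))) := by
  simp only [pairH, sepBiv, imgA, fanCombo, wedgeH, conv, edgeAC, detach, hx, hy, hz, V5.total, masterN, kap, swapBC]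
  ring

/-- **`γ_q` is non-negative on every `a`-image with valid legs** (`q ≤ 2`). [folklore] -/
theorem pairH_imgA_sepBiv_nonneg {q : ℝ} (hq2 : q ≤ 2) {F w : V5} (hF : Valid q F) (hw : Valid q w) :
    0 ≤ pairH q (imgA q F w) (sepBiv q) := by
  rw [pairH_imgA_sepBiv]
  have h1 := hF.nAC
  have h2 := hw.nAB
  have h3 := hw.kapB
  have h4 := hw.nonneg.h0
  have h5 := hw.nonneg.hac
  have h6 : 0 ≤ 2 - q := sub_nonneg.2 hq2
  have h7 : 0 ≤ w.z0 ^ 2 + w.z0 * w.zac + kap (swapBC w) := by positivity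
  have h8 : 0 ≤ (2 - q) * (w.z0 ^ 2 + w.z0 * w.zac + kap (swapBC w)) + masterN q (swapBC w) := by positivity
  positivity

/-- **`γ_q ∈ OSDualS q`** (the dual of the relaxation cone), `q ≤ 2`. [folklore] -/
theorem sepBiv_osDualS {q : ℝ} (hq2 : q ≤ 2) : OSDualS q (sepBiv q) :=
  fun _ _ hF hw => pairH_imgA_sepBiv_nonneg hq2 hF.valid hw.valid

/-- **`γ_q ∈ OSDualA q`** (the dual of the `InKE`-cone), `0 < q ≤ 1`. [folklore] -/
theorem sepBiv_osDualA {q : ℝ} (hq0 : 0 < q) (hq1 : q ≤ 1) : OSDualA q (sepBiv q) :=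
  (sepBiv_osDualS (by linarith)).osDualA hq0 hq1

/-! ### The witness: one rim step after a `b`-spoke prefix, then a `b`-spoke -/

/-- The gadget of the witness: one rim step, `E_{2/5} = (3/5, 0, 2/5, 0, 0)`. [folklore] -/
def witF : V5 := ⟨3 / 5, 0, 2 / 5, 0, 0⟩

/-- The rest of the witness: one `b`-spoke, `BC_{7/10} = (3/10, 0, 0, 7/10, 0)`. [folklore] -/
def witW : V5 := ⟨3 / 10, 0, 0, 7 / 10, 0⟩

/-- `witF = rimStep q (2/5) fanInit`. [folklore] -/
theorem witF_eq (q : ℝ) : witF = rimStep q (2 / 5) fanInit := by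
  rw [fanInit_eq]; ext <;> norm_num [witF, rimStep]

/-- `witW = edgeBC (7/10)`. [folklore] -/
theorem witW_eq : witW = edgeBC (7 / 10) := by
  ext <;> norm_num [witW, edgeBC]

/-- `witF ∈ InKE q`. [folklore] -/
theorem witF_inKE (q : ℝ) : InKE q witF := by
  rw [witF_eq q]; exact InKE.rim (by norm_num) (by norm_num) (fanInit_inKE q)

/-- `witW ∈ InKE q`. [folklore] -/
theorem witW_inKE (q : ℝ) : InKE q witW := by
  have h : InKE q (conv (edgeBC (7 / 10)) delta0) := InKE.step (IsLetter.bc (by norm_num) (by norm_num)) InKE.base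
  have e : conv (edgeBC (7 / 10)) delta0 = witW := by
    ext <;> norm_num [conv, edgeBC, delta0, witW, V5.total]
  rwa [e] at h

/-- **The witness pairing in closed form**: `⟪∧²BC_{7/10}(imgA q E_{2/5} BC_{7/10}), γ_q⟫ = (1−q)²(−2322 + 1647q − 243q²)/125000`. [folklore] -/
theorem pairH_witness (q : ℝ) :
    pairH q (opBC (7 / 10) (imgA q witF witW)) (sepBiv q) = (1 - q) ^ 2 * ((-2322 + 1647 * q - 243 * q ^ 2) / 125000) := by
  simp only [pairH, sepBiv, opBC, Biv.lin3, Biv.add, Biv.smul, opTb, opWb, imgA, fanCombo, wedgeH, conv, edgeAC, detach, hx, hy, hz,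
    V5.total, witF, witW]
  ring

/-- **The witness pairing is negative** for `q < 1`. [folklore] -/
theorem pairH_witness_neg {q : ℝ} (hq1 : q < 1) : pairH q (opBC (7 / 10) (imgA q witF witW)) (sepBiv q) < 0 := by
  rw [pairH_witness]
  have h1 : 0 < (1 - q) ^ 2 := by have : 0 < 1 - q := sub_pos.2 hq1; positivity
  have h2 : -2322 + 1647 * q - 243 * q ^ 2 < 0 := by nlinarith [sq_nonneg q]
  have h3 : (-2322 + 1647 * q - 243 * q ^ 2) / 125000 < 0 := by
    apply div_neg_of_neg_of_pos h2; norm_num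
  exact mul_neg_of_pos_of_neg h1 h3

/-! ### The refutations -/

/-- **`HypBaS q` is false** for every `0 < q < 1`: the `b`-spoke image of the honest word `BC_{7/10} · pin · E_{2/5}` lies outside the
relaxation cone `osConeS q`. [folklore] -/
theorem not_hypBaS {q : ℝ} (hq0 : 0 < q) (hq1 : q < 1) : ¬ HypBaS q := by
  intro hB
  have hF : InS q witF := (witF_inKE q).inS hq0 hq1.le
  have hw : InS q witW := (witW_inKE q).inS hq0 hq1.le
  have h := hB witF witW (7 / 10) hF hw (by norm_num) (by norm_num) (sepBiv q) (sepBiv_osDualS (by linarith))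
  exact absurd h (not_le.2 (pairH_witness_neg hq1))

/-- **`HypBa q` is false** for every `0 < q < 1` (the smaller `InKE`-cone `osConeA q` a fortiori misses the witness). [folklore] -/
theorem not_hypBa {q : ℝ} (hq0 : 0 < q) (hq1 : q < 1) : ¬ HypBa q := by
  intro hB
  have h := hB witF witW (7 / 10) (witF_inKE q) (witW_inKE q) (by norm_num) (by norm_num) (sepBiv q) (sepBiv_osDualA hq0 hq1.le)
  exact absurd h (not_le.2 (pairH_witness_neg hq1))

/-- **`HypShiftS q C` is false** for every `0 < q < 1` and `C ≥ 0` (it implies `HypBaS q`, `hypBaS_of_shift`). [folklore] -/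
theorem not_hypShiftS {q C : ℝ} (hq0 : 0 < q) (hq1 : q < 1) (hC : 0 ≤ C) : ¬ HypShiftS q C :=
  fun h => not_hypBaS hq0 hq1 (hypBaS_of_shift hC h)

/-- **The witness image is not in the relaxation cone**: `∧²BC_{7/10}(imgA q E_{2/5} BC_{7/10}) ∉ osConeS q` (`q < 1`, any `q ≤ 2`...
stated for `q < 1`). [folklore] -/
theorem witness_not_mem_osConeS {q : ℝ} (hq1 : q < 1) : opBC (7 / 10) (imgA q witF witW) ∉ osConeS q :=
  fun h => absurd (h (sepBiv q) (sepBiv_osDualS (by linarith))) (not_le.2 (pairH_witness_neg hq1))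

end ThreeApex

end FK

end Summit.CriticalPhenomena.PercolationContinuityZ3.Theorems
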